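import Summits.CriticalPhenomena.CardyFormulaZ2.Theorems.CardyIKTransportIKLinearTransportStubCoalescingRowKernelTail

/-!
# Stub `stub_CutMarkovLocal` (Loc) — part B: EXPONENTIAL TAIL of the distance to the last CERTIFIED cut row

Support file (`--supports stmt-CriticalPhenomena-5076`, registered sub-goal `isCutCert_tail`). For EVERY column
pattern `S`, every face column `i`, every row `y` and depth `m`:

  `νmix S {x | no row among y-m-1, …, y-1 carries the local cut certificate IsCutCert i · x} ≤ C e^{-c m}`

with the absolute constants of `isCut_tail` (`…StubCoalescingRowKernelTail.lean`). The locality (Loc) of the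
cut-Markov heat bath needs CERTIFIED cut rows (the certificate `IsCutCert` is read from the 15 strip cells of the
rows `c-2, …, c+2` of the configuration, so it survives the restriction of the configuration to a window, whereas a
cut row of the global pinned statistic need not): the proof of `isCut_tail` already runs through the certificates
of `⌊m/5⌋` disjoint blocks (`crk_noCert_le_pow`, finite energy by single-cell flips), so only its last step changes.
-/

noncomputable section

namespace Summit.CriticalPhenomena.CardyFormulaZ2.Theorems.IKLinearTransport.PinnedDiagramExchange

open scoped Classical MeasureTheory ENNReal symmDiff
open Set MeasureTheory
open Literature.Probability.Percolation Literature.Probability.LatticeModels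

/-- No certified cut row in the window ⟹ no certificate in any of the `⌊m/5⌋` blocks of the window. [folklore] -/
theorem crk_noCertRow_subset_noCert (i y : ℤ) (m : ℕ) :
    {x : Obs | ∀ c' : ℤ, y - m - 1 ≤ c' → c' ≤ y - 1 → ¬ IsCutCert i c' x} ⊆ crkNoCert i (y - m - 1) (m / 5) := by
  intro x hx j' hj' hcert
  refine hx (crkCtr (y - m - 1) j') ?_ ?_ hcert
  · simp only [crkCtr]; omega
  · simp only [crkCtr]
    have h5 : 5 * (m / 5) ≤ m := Nat.mul_div_le m 5
    have : (j' : ℤ) + 1 ≤ (m / 5 : ℕ) := by exact_mod_cast hj'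
    push_cast at this h5 ⊢
    have h5' : (5 : ℤ) * ((m / 5 : ℕ) : ℤ) ≤ m := by exact_mod_cast h5
    linarith

/-- The measurable event "no certified cut row in the window". [folklore] -/
theorem measurableSet_noCertRow (i y : ℤ) (m : ℕ) :
    MeasurableSet {x : Obs | ∀ c' : ℤ, y - m - 1 ≤ c' → c' ≤ y - 1 → ¬ IsCutCert i c' x} := by
  have : {x : Obs | ∀ c' : ℤ, y - m - 1 ≤ c' → c' ≤ y - 1 → ¬ IsCutCert i c' x} =
      ⋂ c' ∈ Finset.Icc (y - m - 1) (y - 1), {x | IsCutCert i c' x}ᶜ := by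
    ext x; simp
  rw [this]
  exact Finset.measurableSet_biInter _ fun c' _ => (measurableSet_isCutCert i c').compl

/-- EXPONENTIAL TAIL OF THE DISTANCE TO THE LAST CERTIFIED CUT ROW (registered sub-goal `isCutCert_tail`): for
absolute constants `C, c > 0` and EVERY column pattern `S`, face column `i`, row `y` and depth `m`, the
`νmix S`-probability that none of the rows `y-m-1, …, y-1` carries the local cut certificate is at most `C e^{-cm}`
(finite energy, uniformly in the pattern). [folklore] -/
theorem isCutCert_tail : ∃ C c : ℝ, 0 < c ∧ 0 ≤ C ∧ ∀ (S : Set ℤ) (i y : ℤ) (m : ℕ),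
    (νmix S) {x | ∀ c' : ℤ, y - m - 1 ≤ c' → c' ≤ y - 1 → ¬ IsCutCert i c' x} ≤
      ENNReal.ofReal (C * Real.exp (-c * m)) := by
  -- adapted from `isCut_tail` (…StubCoalescingRowKernelTail.lean): the same blocks, the certificates themselves
  obtain ⟨K, hKtop, hcell⟩ := crk_cellFlips
  haveI : IsProbabilityMeasure μIK := by unfold μIK; infer_instance
  obtain ⟨h2K1, hMtop, hMpos⟩ := crsw_factor_props hcell hKtop 15
  set M : ℝ := ((2 * K) ^ 15).toReal with hM
  set c : ℝ := (5 * M)⁻¹ with hc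
  have hcpos : 0 < c := by positivity
  refine ⟨Real.exp (4 * c), c, hcpos, (Real.exp_pos _).le, fun S i y m => ?_⟩
  haveI := isProbabilityMeasure_nuMix S
  have hobs : Measurable (obs S) := (measurable_obs' S).2.2
  have h1 : (νmix S) {x | ∀ c' : ℤ, y - m - 1 ≤ c' → c' ≤ y - 1 → ¬ IsCutCert i c' x} ≤
      μIK (obs S ⁻¹' crkNoCert i (y - m - 1) (m / 5)) := by
    refine (measure_mono (crk_noCertRow_subset_noCert i y m)).trans (le_of_eq ?_)
    rw [νmix, Measure.map_apply hobs (measurableSet_crkNoCert i _ _)]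
  have h2 : (μIK (obs S ⁻¹' crkNoCert i (y - m - 1) (m / 5))).toReal ≤ (1 - M⁻¹) ^ (m / 5) :=
    crk_noCert_le_pow S i (y - m - 1) hcell hKtop (m / 5)
  have hM1 : 1 ≤ M := by
    have : (1 : ℝ≥0∞) ≤ (2 * K) ^ 15 := one_le_pow_of_one_le' h2K1 _
    simpa [hM] using ENNReal.toReal_mono hMtop this
  have hq0 : 0 ≤ 1 - M⁻¹ := by rw [sub_nonneg]; exact inv_le_one_of_one_le₀ hM1
  have hq1 : 1 - M⁻¹ ≤ Real.exp (-M⁻¹) := Real.one_sub_le_exp_neg _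
  have h3 : (1 - M⁻¹) ^ (m / 5) ≤ Real.exp (4 * c) * Real.exp (-c * m) := by
    calc (1 - M⁻¹) ^ (m / 5) ≤ (Real.exp (-M⁻¹)) ^ (m / 5) := pow_le_pow_left₀ hq0 hq1 _
      _ = Real.exp (-M⁻¹ * (m / 5 : ℕ)) := by rw [← Real.exp_nat_mul]; ring_nf
      _ ≤ Real.exp (4 * c + -c * m) := by
          refine Real.exp_le_exp.2 ?_
          have h5 : (m : ℝ) ≤ 5 * ((m / 5 : ℕ) : ℝ) + 4 := by
            have := Nat.lt_mul_div_succ m (show 0 < 5 by norm_num)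
            have : (m : ℝ) + 1 ≤ 5 * (((m / 5 : ℕ) : ℝ) + 1) := by exact_mod_cast this
            linarith
          have hMinv : M⁻¹ = 5 * c := by rw [hc]; field_simp
          rw [hMinv]
          nlinarith [hcpos]
      _ = Real.exp (4 * c) * Real.exp (-c * m) := Real.exp_add _ _
  calc (νmix S) {x | ∀ c' : ℤ, y - m - 1 ≤ c' → c' ≤ y - 1 → ¬ IsCutCert i c' x}
      ≤ μIK (obs S ⁻¹' crkNoCert i (y - m - 1) (m / 5)) := h1
    _ = ENNReal.ofReal ((μIK (obs S ⁻¹' crkNoCert i (y - m - 1) (m / 5))).toReal) :=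
        (ENNReal.ofReal_toReal (measure_ne_top _ _)).symm
    _ ≤ ENNReal.ofReal (Real.exp (4 * c) * Real.exp (-c * m)) := ENNReal.ofReal_le_ofReal (h2.trans h3)

end Summit.CriticalPhenomena.CardyFormulaZ2.Theorems.IKLinearTransport.PinnedDiagramExchange
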